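import Summits.BirchSwinnertonDyer.BirchSwinnertonDyer.Theorems.TeichmullerTwistDescentTwistedPeriodLatticeTwistOptimality
import Literature.NumberTheory.EllipticCurves.ModularDegreeQuadraticTwistProofs
import HarnessLib

/-!
# Twist optimality for a GIVEN minimal model of the `p*`-twist, with the modular-degree step
# (route `TeichmullerTwistDescent`, LINE 11, K stmt-BirchSwinnertonDyer-25368; bridge to EF57's TDS cruxes)

Cell `pub/bsd-wall`, seat `bsd-line-ttd-p1` (g5). THEOREMS ONLY, theses-cone free. The model-free
(`∃ V`) statements of `TwistFrame.exists_twist_frame` / `TwistOptimality.exists_optimal_twist_datum_of_modularity`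
re-run for an ARBITRARY globally minimal model `V` of `W ⊗ ℚ(√p*)` (`C • W^{(p*)} = V` given — the shape in
which the EF57 cruxes TDS57/TDS11 quantify), and completed by Watkins' degree formula
(`deg_mul_sq_mul_sq_eq_of_quadraticTwist_pStar`: `deg(D_V)·c(D)²·u² = p·deg(D)·c(D_V)²`):

* `exists_twist_frame_of_model` — `ord_p u(C) = 0`, `E[p]` irreducible for `V`, a Néron pair `L_V`, the
  optimal member `W₀ ∼ V` with a lattice-optimal datum `D₀` at level `N(W)` and `f_D ⊗ χ_p = f_{D₀}`.
* `exists_optimalDatum_of_minimal_twist_of_modularity` — GRANTED modularity, for `W` optimal (lattice-optimal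
  conductor-level `D`), `p ≥ 5` additive potentially good with `ord_p Δ_min < 6`, `E[p]` irreducible:
  **`V` carries a lattice-optimal datum `D_V` at level `N(W)` with newform `f_D ⊗ χ_p`, and EITHER
  `u·c(D) = ±c(D_V)` and `deg(D_V) = p·deg(D)` (saturation = K at `(W,p,D)`, the twist-degree STEP UP)
  OR `u·c(D) = ±p·c(D_V)` and `deg(D) = p·deg(D_V)` (Edixhoven's case 1, the step DOWN).**
So on these rows K ⟺ `ord_p deg(φ_V) = ord_p deg(φ_W) + 1` for the two optimal parametrisations — the
currency of the twist-degree cruxes. BSD is not proved by this; Manin's conjecture is not proved by this.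
[cite: EdixhovenManin1991, §4] [cite: Watkins2002, §2.1 p. 491] [cite: Stevens1989, Lemma (5.4) p. 97]
-/

set_option autoImplicit false
-- single-conjunct summit: `Summit.BirchSwinnertonDyer.BirchSwinnertonDyer.…` repeats the name by design
set_option linter.dupNamespace false

noncomputable section

open scoped Classical NumberField

open WeierstrassCurve IsDedekindDomain Rat.HeightOneSpectrum Literature.NumberTheory.EllipticCurves Literature.NumberTheory.EllipticCurves.ModularForms
  Literature.NumberTheory.EllipticCurves.Rank1Residual
  Summit.BirchSwinnertonDyer.Rank1Residual Summit.BirchSwinnertonDyer.Rank1Residual.Additive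
  Summit.BirchSwinnertonDyer.BirchSwinnertonDyer.Theorems.TeichmullerTwistDescentStarInvolution

namespace Summit.BirchSwinnertonDyer.BirchSwinnertonDyer.Theorems.TeichmullerTwistDescent.TwistOptimalityOfModel

open PeriodLatticeIndexParity TwistedPeriodLatticeDichotomy TwistOptimality

/-- Level bookkeeping: a lattice-optimal datum at level `N` is one at any equal level. [folklore] -/
private theorem exists_optimalDatum_of_level_eq' {X : WeierstrassCurve ℚ} {N M : ℕ} [NeZero N]
    [NeZero M] (h : N = M) (D : ModularParametrizationData X N)
    (hopt : ∀ z ∈ D.L.lattice, ∃ w ∈ periodLattice D.f, z = D.c * w) :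
    ∃ D' : ModularParametrizationData X M, ∀ z ∈ D'.L.lattice, ∃ w ∈ periodLattice D'.f, z = D'.c * w := by
  subst h
  exact ⟨D, hopt⟩

/-- **The twist frame of a GIVEN minimal model `V` of the `p*`-twist** (cf. `TwistFrame.exists_twist_frame`):
for `W/ℚ` globally minimal, additive and potentially good at `p ≥ 5` with `ord_p Δ_min < 6`, `E[p]`
irreducible, `D` a conductor-level datum (`p² ∣ N`), and `C • W^{(p*)} = V` globally minimal, GRANTED
modularity: `ord_p u(C) = 0`; `E[p]` is irreducible for `V`; and there are a Néron pair `L_V` of `V` and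
the `X₀(N)`-optimal member `W₀` of the class of `V` with a lattice-optimal datum `D₀` at level `N(W)`
whose newform is `f_D ⊗ χ_p`. [cite: Stevens1989, §5 pp. 96–97] [cite: PastenShimura2024, §2 p. 12] -/
theorem exists_twist_frame_of_model (hnf : exists_isNewformOf) (W : WeierstrassCurve ℚ) [W.IsElliptic]
    [W.IsGloballyMinimal] (p : ℕ) [Fact p.Prime] [NeZero (W.conductorNorm ℤ)]
    (D : ModularParametrizationData W (W.conductorNorm ℤ)) (hsq : p ^ 2 ∣ W.conductorNorm ℤ)
    (hp5 : 5 ≤ p) (hadd : Rank1Residual.Addv W p) (hirr : Rank1Residual.Irr W p)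
    (hj : 0 ≤ padicValRat p W.j) (hW6 : padicValInt p W.minimalDiscriminantInt < 6)
    (hχ : ((quadraticChar (ZMod p)).ringHomComp (Int.castRingHom ℂ)).IsQuadratic)
    (V : WeierstrassCurve ℚ) [V.IsElliptic] [V.IsGloballyMinimal] (C : VariableChange ℚ)
    (hC : C • W.quadraticTwist ((-1 : ℚ) ^ (p / 2) * p) = V) :
    padicValRat p (C.u : ℚ) = 0 ∧ Rank1Residual.Irr V p ∧ Rank1Residual.Addv V p ∧
    ∃ (W₀ : WeierstrassCurve ℚ) (_ : W₀.IsElliptic) (_ : W₀.IsGloballyMinimal) (LV : PeriodPair)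
      (D₀ : ModularParametrizationData W₀ (W.conductorNorm ℤ)),
      IsNeronLatticeOf (V.baseChange ℂ) LV ∧ IsIsogenous V W₀ ∧
      (∀ z ∈ D₀.L.lattice, ∃ w ∈ periodLattice D₀.f, z = D₀.c * w) ∧
      charTwist (W.conductorNorm ℤ) (dvd_refl _) hsq hχ D.f = D₀.f := by
  have hpP : p.Prime := Fact.out
  have hp2 : p ≠ 2 := by omega
  have hprim : DirichletCharacter.IsPrimitive ((quadraticChar (ZMod p)).ringHomComp (Int.castRingHom ℂ)) :=
    isPrimitive_quadraticChar_ringHomComp p hp2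
  haveI : NeZero (V.conductorNorm ℤ) := ⟨(conductorNorm_pos_holds V).ne'⟩
  obtain ⟨hV, -, -⟩ := addv_of_twist_pStar p hp2 W V hj hW6 C hC
  obtain ⟨hu, -⟩ := padicValRat_u_eq_zero_and_padicValInt_eq_of_twist_pStar p hp2 W V hW6 C hC
  have hNV : V.conductorNorm ℤ = W.conductorNorm ℤ :=
    conductorNorm_eq_of_twist_pStar p hp5 W V hadd hV C hC
  have hd0 : ((-1 : ℚ) ^ (p / 2) * p) ≠ 0 :=
    mul_ne_zero (pow_ne_zero _ (by norm_num)) (by exact_mod_cast hpP.ne_zero)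
  haveI : (W.quadraticTwist ((-1 : ℚ) ^ (p / 2) * p)).IsElliptic := W.isElliptic_quadraticTwist hd0
  have hC' : C⁻¹ • V = W.quadraticTwist ((-1 : ℚ) ^ (p / 2) * p) := by rw [← hC, inv_smul_smul]
  have hirrV : Irr V p :=
    BurungaleSkinnerTianWan2024.hasIrreducibleModPGaloisRep_of_smul_eq_quadraticTwist W V p hd0 hC' hirr
  haveI : (V.baseChange ℂ).IsElliptic := by rw [WeierstrassCurve.baseChange]; infer_instance
  obtain ⟨LV, hLV⟩ := exists_isNeronLatticeOf_holds (V.baseChange ℂ)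
  obtain ⟨W₀, hE₀, hM₀, hNz₀, D₀', hiso, hN₀, hopt₀'⟩ := X12.exists_isIsogenous_optimal hnf V
  haveI := hE₀
  haveI := hM₀
  haveI := hNz₀
  obtain ⟨D₀, hopt₀⟩ := exists_optimalDatum_of_level_eq' (hN₀.trans hNV) D₀' hopt₀'
  have hfV : IsNewformOf V D₀.f := D₀.isNewformOf.of_isIsogenous hiso
  obtain ⟨hcast, -⟩ := pStar_intCast p
  have hcoef : ∀ n : ℕ,
      cuspCoeff (charTwist (W.conductorNorm ℤ) (dvd_refl _) hsq hχ D.f) n = cuspCoeff D₀.f n := by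
    intro n
    rw [cuspCoeff_charTwist (W.conductorNorm ℤ) (dvd_refl _) hsq hχ hprim, D.isNewformOf.2 n,
      hfV.2 n, quadraticChar_ringHomComp_apply_natCast p n, ← hC, LFunction_smul]
    by_cases hpn : p ∣ n
    · -- both sides vanish: `W` and the twisted model `C⁻¹ • V` are additive at `p`
      have hvO : (primesEquiv ((primesEquiv (R := 𝓞 ℚ)).symm ⟨p, hpP⟩) : ℕ) = p := by
        rw [Equiv.apply_symm_apply]
      have hVadd : V.HasAdditiveReductionAt ((primesEquiv (R := 𝓞 ℚ)).symm ⟨p, hpP⟩) := by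
        set vq : HeightOneSpectrum ℤ := (primesEquiv (R := ℤ)).symm ⟨p, hpP⟩ with hvq
        have haddX : V.HasAdditiveReductionAt vq := by
          rcases V.hasGoodReductionAt_or_hasMultiplicativeReductionAt_or_hasAdditiveReductionAt vq with
            hg | hm | ha
          · exact absurd ((V.hasGoodReductionAtPrime_iff_hasGoodReductionAt_holds ⟨p, hpP⟩).mpr hg) hV.1
          · exact absurd
              ((V.hasMultiplicativeReductionAtPrime_iff_hasMultiplicativeReductionAt_holds ⟨p, hpP⟩).mpr hm)
              hV.2
          · exact ha
        exact (V.hasAdditiveReductionAt_int_iff_ringOfIntegers ⟨p, hpP⟩).mp haddX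
      rw [W.LFunction_apply_eq_zero_of_not_good_of_not_mult p hadd.1 hadd.2 hpn,
        (W.quadraticTwist ((-1 : ℚ) ^ (p / 2) * p)).LFunction_apply_eq_zero_of_hasAdditiveReductionAt
          hvO ?_ hpn]
      · push_cast; ring
      · rw [← hC']
        exact (hasAdditiveReductionAt_smul_iff_holds _ V C⁻¹).mpr hVadd
    · rw [← hcast, W.LFunction_quadraticTwist_pStar_apply hp2 hpn]
      have hne : ((n : ℤ) : ZMod p) ≠ 0 := by
        rw [Int.cast_natCast, Ne, ZMod.natCast_eq_zero_iff]
        exact hpn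
      push_cast
      rcases legendreSym.eq_one_or_neg_one p hne with h1 | h1
      · rw [show (legendreSym p (n : ℤ)) = legendreSym p n from rfl, h1]
      · rw [show (legendreSym p (n : ℤ)) = legendreSym p n from rfl, h1]
  exact ⟨hu, hirrV, hV, W₀, hE₀, hM₀, LV, D₀, hLV, hiso, hopt₀, eq_of_forall_cuspCoeff_eq_gamma0 hcoef⟩


/-- **Twist optimality and the twist-degree step for a GIVEN minimal model of the `p*`-twist, GRANTED
modularity.** `W/ℚ` globally minimal, additive and potentially good at `p ≥ 5` (`0 ≤ ord_p j`) with
`ord_p Δ_min < 6`, `E[p]` irreducible, `D` a LATTICE-OPTIMAL conductor-level datum of `W` (`p² ∣ N`), and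
`C • W^{(p*)} = V` globally minimal. Then `V` carries a LATTICE-OPTIMAL datum `D_V` at level `N(W)` with
newform `f_D ⊗ χ_p` (so `V` is the `X₀(N)`-optimal curve of the twisted class), and EITHER
`u·c(D) = ±c(D_V)` with `deg(D_V) = p·deg(D)` (saturation — K at `(W, p, D)`) OR `u·c(D) = ±p·c(D_V)` with
`deg(D) = p·deg(D_V)` (Edixhoven's case 1). Proof: index dichotomy
(`TwistedPeriodLatticeDichotomy.index_dichotomy_of_modularity`), `Λ_V = r·Λ_{W₀}` with `r` rational hence
`±1` (`TwistOptimality.lattice_eq_of_rat_scaling`), the datum `(f ⊗ χ, Λ_V, c₀)`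
(`ModularParametrizationData.exists_of_isNewformOf`), and Watkins' formula
`deg(D_V)·c(D)²·u² = p·deg(D)·c(D_V)²` (`deg_mul_sq_mul_sq_eq_of_quadraticTwist_pStar`).
[cite: EdixhovenManin1991, §4] [cite: Watkins2002, §2.1 p. 491] [cite: Stevens1989, Lemma (5.4) p. 97] -/
theorem exists_optimalDatum_of_minimal_twist_of_modularity (hnf : exists_isNewformOf)
    (W : WeierstrassCurve ℚ) [W.IsElliptic] [W.IsGloballyMinimal] (p : ℕ) [Fact p.Prime]
    [NeZero (W.conductorNorm ℤ)] (D : ModularParametrizationData W (W.conductorNorm ℤ))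
    (hsq : p ^ 2 ∣ W.conductorNorm ℤ) (hp5 : 5 ≤ p) (hadd : Rank1Residual.Addv W p)
    (hirr : Rank1Residual.Irr W p) (hj : 0 ≤ padicValRat p W.j)
    (hW6 : padicValInt p W.minimalDiscriminantInt < 6)
    (hopt : ∀ z ∈ D.L.lattice, ∃ w ∈ periodLattice D.f, z = D.c * w)
    (V : WeierstrassCurve ℚ) [V.IsElliptic] [V.IsGloballyMinimal] (C : VariableChange ℚ)
    (hC : C • W.quadraticTwist ((-1 : ℚ) ^ (p / 2) * p) = V) :
    ∃ DV : ModularParametrizationData V (W.conductorNorm ℤ),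
      (∀ z ∈ DV.L.lattice, ∃ w ∈ periodLattice DV.f, z = DV.c * w) ∧
      DV.f = charTwist (W.conductorNorm ℤ) (dvd_refl _) hsq (isQuadratic_quadraticChar_ringHomComp p) D.f ∧
      ((((C.u : ℚ) * D.c = DV.c ∨ (C.u : ℚ) * D.c = -DV.c) ∧ DV.deg = p * D.deg) ∨
        (((C.u : ℚ) * D.c = p * DV.c ∨ (C.u : ℚ) * D.c = -(p * DV.c)) ∧ D.deg = p * DV.deg)) := by
  have hpP : p.Prime := Fact.out
  have hp2 : p ≠ 2 := by omega
  have hχ := isQuadratic_quadraticChar_ringHomComp p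
  have hprim : DirichletCharacter.IsPrimitive ((quadraticChar (ZMod p)).ringHomComp (Int.castRingHom ℂ)) :=
    isPrimitive_quadraticChar_ringHomComp p hp2
  set G : ℂ := gaussSum ((quadraticChar (ZMod p)).ringHomComp (Int.castRingHom ℂ))
    (ZMod.stdAddChar (N := p)) with hGdef
  have hG0 : G ≠ 0 := gaussSum_stdAddChar_ne_zero_of_isPrimitive hprim
  set fχ := charTwist (W.conductorNorm ℤ) (dvd_refl _) hsq hχ D.f with hfχdef
  have hStevens : ∀ w ∈ periodLattice fχ, G * w ∈ periodLattice D.f := fun w hw ↦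
    gaussSum_mul_mem_periodLattice_of_mem_charTwist (W.conductorNorm ℤ) (dvd_refl _) hsq hχ hprim D.f hw
  have hFrame : ∀ z ∈ periodLattice D.f, ∃ w ∈ periodLattice fχ, (p : ℂ) * z = G * w := fun z hz ↦
    TwistedPeriodLatticeIndexFrame.natCast_mul_mem_gaussSum_mul_periodLattice_charTwist_of_modularParametrizationData
      W p D hsq _ hχ hprim hz
  -- the frame of the given model
  obtain ⟨hu, -, hV, W₀, hE₀, hM₀, LV, D₀, hLV, hiso, hopt₀, hfeq⟩ :=
    exists_twist_frame_of_model hnf W p D hsq hp5 hadd hirr hj hW6 hχ V C hC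
  haveI := hE₀
  haveI := hM₀
  have htw : ∀ x : ℂ, x ∈ LV.lattice ↔ G * ((((C.u : ℚ) : ℂ))⁻¹ * x) ∈ D.L.lattice := fun x ↦
    mem_lattice_twist_pStar_iff p hp2 W V D.isNeronLattice hLV C hC x
  have hc : D.c ≠ 0 := D.maninConstant_ne_zero_holds
  have hc₀ : D₀.c ≠ 0 := D₀.maninConstant_ne_zero_holds
  have hu0 : (C.u : ℚ) ≠ 0 := C.u.ne_zero
  have hcℂ : (D.c : ℂ) ≠ 0 := by exact_mod_cast hc
  have hc₀ℂ : (D₀.c : ℂ) ≠ 0 := by exact_mod_cast hc₀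
  have huℂ : (((C.u : ℚ) : ℚ) : ℂ) ≠ 0 := by exact_mod_cast hu0
  have hpℂ : (p : ℂ) ≠ 0 := by exact_mod_cast hpP.ne_zero
  have hfV : IsNewformOf V D₀.f := D₀.isNewformOf.of_isIsogenous hiso
  -- Watkins' degree formula for the pair `(D, D_V)`
  obtain ⟨hcast, -⟩ := pStar_intCast p
  have hC_int : C • W.quadraticTwist (((-1 : ℤ) ^ (p / 2) * p : ℤ) : ℚ) = V := by rw [hcast]; exact hC
  have hW0 : ∀ n : ℕ, p ∣ n → W.LFunction n = 0 := fun n hn ↦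
    W.LFunction_apply_eq_zero_of_not_good_of_not_mult p hadd.1 hadd.2 hn
  have hV0 : ∀ n : ℕ, p ∣ n → V.LFunction n = 0 := fun n hn ↦
    V.LFunction_apply_eq_zero_of_not_good_of_not_mult p hV.1 hV.2 hn
  -- common conclusion from `Λ_V = Λ_{W₀}` and the Manin relation
  have conclude : (∀ z : ℂ, z ∈ D₀.L.lattice ↔ z ∈ LV.lattice) →
      (((C.u : ℚ) * D.c = D₀.c ∨ (C.u : ℚ) * D.c = -D₀.c) ∨
        ((C.u : ℚ) * D.c = p * D₀.c ∨ (C.u : ℚ) * D.c = -(p * D₀.c))) →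
      ∃ DV : ModularParametrizationData V (W.conductorNorm ℤ),
        (∀ z ∈ DV.L.lattice, ∃ w ∈ periodLattice DV.f, z = DV.c * w) ∧ DV.f = fχ ∧
        ((((C.u : ℚ) * D.c = DV.c ∨ (C.u : ℚ) * D.c = -DV.c) ∧ DV.deg = p * D.deg) ∨
          (((C.u : ℚ) * D.c = p * DV.c ∨ (C.u : ℚ) * D.c = -(p * DV.c)) ∧ D.deg = p * DV.deg)) := by
    intro hLeq hrel
    have hle : ∀ z ∈ periodLattice D₀.f, (D₀.c : ℂ) * z ∈ LV.lattice := fun z hz ↦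
      (hLeq _).mp (D₀.smul_periodLattice_le z hz)
    obtain ⟨DV, hDVf, hDVL, hDVc⟩ := ModularParametrizationData.exists_of_isNewformOf hfV hLV hc₀ hle
    have hoptV : ∀ z ∈ DV.L.lattice, ∃ w ∈ periodLattice DV.f, z = DV.c * w := by
      intro z hz
      rw [hDVL] at hz
      obtain ⟨w, hw, hzw⟩ := hopt₀ z ((hLeq z).mpr hz)
      exact ⟨w, by rw [hDVf]; exact hw, by rw [hDVc]; exact hzw⟩
    -- Watkins: `deg(D_V) c² u² = p deg(D) c_V²`
    have hWat := ModularParametrizationData.deg_mul_sq_mul_sq_eq_of_quadraticTwist_pStar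
      (W := W) (W' := V) hp2 C hC_int hW0 hV0 D DV
    refine ⟨DV, hoptV, by rw [hDVf]; exact hfeq.symm, ?_⟩
    rw [hDVc] at hWat ⊢
    have hdeg0 : (0 : ℝ) < D.deg := by exact_mod_cast D.deg_pos
    have hdegV0 : (0 : ℝ) < DV.deg := by exact_mod_cast DV.deg_pos
    have hc₀ℝ : ((D₀.c : ℝ)) ≠ 0 := by exact_mod_cast hc₀
    rcases hrel with hK | h1
    · left
      refine ⟨hK, ?_⟩
      have hsq' : ((C.u : ℚ) : ℝ) ^ 2 * (D.c : ℝ) ^ 2 = (D₀.c : ℝ) ^ 2 := by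
        rcases hK with h | h
        · have h' := congrArg (fun t : ℚ ↦ (t : ℝ) ^ 2) h
          push_cast at h'
          linear_combination h'
        · have h' := congrArg (fun t : ℚ ↦ (t : ℝ) ^ 2) h
          push_cast at h'
          linear_combination h'
      have key : (DV.deg : ℝ) * (D₀.c : ℝ) ^ 2 = p * D.deg * (D₀.c : ℝ) ^ 2 := by
        rw [← hWat]; rw [← hsq']; ring
      have key' : (DV.deg : ℝ) = p * D.deg := by
        have := mul_right_cancel₀ (pow_ne_zero 2 hc₀ℝ) key
        exact this
      exact_mod_cast key'
    · right
      refine ⟨h1, ?_⟩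
      have hsq' : ((C.u : ℚ) : ℝ) ^ 2 * (D.c : ℝ) ^ 2 = (p : ℝ) ^ 2 * (D₀.c : ℝ) ^ 2 := by
        rcases h1 with h | h
        · have h' := congrArg (fun t : ℚ ↦ (t : ℝ) ^ 2) h
          push_cast at h'
          linear_combination h'
        · have h' := congrArg (fun t : ℚ ↦ (t : ℝ) ^ 2) h
          push_cast at h'
          linear_combination h'
      have key : (DV.deg : ℝ) * ((p : ℝ) ^ 2 * (D₀.c : ℝ) ^ 2) = p * D.deg * (D₀.c : ℝ) ^ 2 := by
        rw [← hWat, ← hsq']; ring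
      have hpℝ : (p : ℝ) ≠ 0 := by exact_mod_cast hpP.ne_zero
      have key' : (D.deg : ℝ) = p * DV.deg := by
        have h2 : ((p : ℝ) * (D₀.c : ℝ) ^ 2) * ((p : ℝ) * DV.deg) = ((p : ℝ) * (D₀.c : ℝ) ^ 2) * D.deg := by
          linear_combination key
        exact (mul_left_cancel₀ (mul_ne_zero hpℝ (pow_ne_zero 2 hc₀ℝ)) h2).symm
      exact_mod_cast key'
  rcases index_dichotomy_of_modularity hnf W p D hsq hp5 hadd hirr hj hW6 hopt _ hχ hprim with hsat | hcase
  · -- saturated case: `Λ_V = (uc/c₀) Λ_{W₀}`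
    set r : ℚ := (C.u : ℚ) * (D.c : ℚ) / (D₀.c : ℚ) with hrdef
    have hr0 : r ≠ 0 := by
      rw [hrdef]; exact div_ne_zero (mul_ne_zero hu0 (by exact_mod_cast hc)) (by exact_mod_cast hc₀)
    have hrℂ : ((r : ℚ) : ℂ) = (((C.u : ℚ) : ℚ) : ℂ) * (D.c : ℂ) / (D₀.c : ℂ) := by
      rw [hrdef]; push_cast; ring
    have hr1 : ∀ z ∈ D₀.L.lattice, ((r : ℚ) : ℂ) * z ∈ LV.lattice := by
      intro x hx
      obtain ⟨w', hw', rfl⟩ := hopt₀ x hx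
      rw [← hfeq] at hw'
      have h1 : (D.c : ℂ) * (G * w') ∈ D.L.lattice := D.smul_periodLattice_le _ (hStevens w' hw')
      have e : G * ((((C.u : ℚ) : ℚ) : ℂ)⁻¹ * (((r : ℚ) : ℂ) * ((D₀.c : ℂ) * w'))) = (D.c : ℂ) * (G * w') := by
        rw [hrℂ]
        field_simp
      rw [htw, e]
      exact h1
    have hr2 : ∀ z ∈ LV.lattice, (((r⁻¹ : ℚ) : ℚ) : ℂ) * z ∈ D₀.L.lattice := by
      intro y hy
      have h1 := (htw y).mp hy
      obtain ⟨z, hz, hz'⟩ := hopt _ h1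
      obtain ⟨w, hw, rfl⟩ := hsat z hz
      have h2 : (D₀.c : ℂ) * w ∈ D₀.L.lattice := D₀.smul_periodLattice_le _ (hfeq ▸ hw)
      have hy' : y = (((C.u : ℚ) : ℚ) : ℂ) * ((D.c : ℂ) * (G * w)) / G := by
        rw [← hz']
        field_simp
      have e : (((r⁻¹ : ℚ) : ℚ) : ℂ) * y = (D₀.c : ℂ) * w := by
        rw [hy', Rat.cast_inv, hrℂ]
        field_simp
      rw [e]
      exact h2
    obtain ⟨hr, hLeq⟩ := lattice_eq_of_rat_scaling D₀.isNeronLattice hLV hr0 hr1 hr2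
    refine conclude hLeq (Or.inl ?_)
    have e : (C.u : ℚ) * D.c = r * D₀.c := by rw [hrdef]; field_simp
    rcases hr with h | h
    · exact Or.inl (by rw [e, h, one_mul])
    · exact Or.inr (by rw [e, h, neg_one_mul])
  · -- Edixhoven's case 1: `Λ_V = (uc/(pc₀)) Λ_{W₀}`
    set r : ℚ := (C.u : ℚ) * (D.c : ℚ) / ((p : ℚ) * (D₀.c : ℚ)) with hrdef
    have hr0 : r ≠ 0 := by
      rw [hrdef]
      exact div_ne_zero (mul_ne_zero hu0 (by exact_mod_cast hc))
        (mul_ne_zero (by exact_mod_cast hpP.ne_zero) (by exact_mod_cast hc₀))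
    have hrℂ : ((r : ℚ) : ℂ) = (((C.u : ℚ) : ℚ) : ℂ) * (D.c : ℂ) / ((p : ℂ) * (D₀.c : ℂ)) := by
      rw [hrdef]; push_cast; ring
    have hr1 : ∀ z ∈ D₀.L.lattice, ((r : ℚ) : ℂ) * z ∈ LV.lattice := by
      intro x hx
      obtain ⟨w', hw', rfl⟩ := hopt₀ x hx
      rw [← hfeq] at hw'
      obtain ⟨z, hz, hzw⟩ := hcase w' hw'
      have h1 : (D.c : ℂ) * z ∈ D.L.lattice := D.smul_periodLattice_le _ hz
      have e : G * ((((C.u : ℚ) : ℚ) : ℂ)⁻¹ * (((r : ℚ) : ℂ) * ((D₀.c : ℂ) * w'))) = (D.c : ℂ) * z := by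
        rw [hrℂ]
        field_simp
        linear_combination hzw
      rw [htw, e]
      exact h1
    have hr2 : ∀ z ∈ LV.lattice, (((r⁻¹ : ℚ) : ℚ) : ℂ) * z ∈ D₀.L.lattice := by
      intro y hy
      have h1 := (htw y).mp hy
      obtain ⟨z, hz, hz'⟩ := hopt _ h1
      obtain ⟨w', hw', hw''⟩ := hFrame z hz
      have h2 : (D₀.c : ℂ) * w' ∈ D₀.L.lattice := D₀.smul_periodLattice_le _ (hfeq ▸ hw')
      have hy' : y = (((C.u : ℚ) : ℚ) : ℂ) * ((D.c : ℂ) * z) / G := by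
        rw [← hz']
        field_simp
      have e : (((r⁻¹ : ℚ) : ℚ) : ℂ) * y = (D₀.c : ℂ) * w' := by
        rw [hy', Rat.cast_inv, hrℂ]
        field_simp
        linear_combination hw''
      rw [e]
      exact h2
    obtain ⟨hr, hLeq⟩ := lattice_eq_of_rat_scaling D₀.isNeronLattice hLV hr0 hr1 hr2
    refine conclude hLeq (Or.inr ?_)
    have e : (C.u : ℚ) * D.c = r * (p * D₀.c) := by rw [hrdef]; field_simp
    rcases hr with h | h
    · exact Or.inl (by rw [e, h, one_mul])
    · exact Or.inr (by rw [e, h, neg_one_mul])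

end Summit.BirchSwinnertonDyer.BirchSwinnertonDyer.Theorems.TeichmullerTwistDescent.TwistOptimalityOfModel

end
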